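import Summits.ValiantsHypothesis.ValiantsHypothesis.Theorems.LacunarySymmetroidMatrixDescartesCensusTropicalKLaw

/-!
# Route «KPlusLogSqLaw», crux `TropicalB` (stmt-ValiantsHypothesis-19771) — REFRESH EXCLUSIVITY (structure part):
# the one-column exchange, the ROTATION LEMMA, and «a class switch of a cell refreshes at most one permutation through it»

HONEST FRAMING.  Helper toward the crux `Summit.ValiantsHypothesis.ValiantsHypothesis.Theses.KPlusLogSqLaw.TropicalB` (ledger item
`stmt-ValiantsHypothesis-19771`, registered stubs `stub_tropThin` / `stub_tropFat` of `Cruxes/TropicalB/Lines/birth.lean`; cell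
`pub-symmetroid`, seat val-sym-trop-p4 g4, 2026-08-26; `--supports … --as helper`).  STRUCTURAL facts about sign-alternating dominant
chains of an ARBITRARY dominance design of any format `(m, K)`; their counting consequence — the HALF-THIN LAW
`2(T(m,K)+1) ≤ 2·m! + (m!·m + m²)(K−1)`, `T(3,K) ≤ ⌊(27K−17)/2⌋` — is the companion file `KPlusLogSqLawTropicalBHalfThin.lean`.  Both live in
the SUPER-FAT corner `K ≫ m`, OFF the window `⌊log₂ m⌋ + 1 < K < m` of the crux; nothing here bears on `TropicalB` in the window, on
`WeakLifting` / `Lifting`, on the cell's real census / DoorA26 / DoorA34, on `MatrixDescartes` (stmt-ValiantsHypothesis-18050) or on VP ≠ VNP.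

WHAT IS NEW.  The tropical upper bounds of the tree are slope counting (`tropRootLawAt_choose` and its entropy / window forms) and
PER-PERMUTATION monotonicity (the thin law `tropRootLawAt_thin`: along the sub-chain of terms with a fixed permutation `σ` the class of
each of `σ`'s `m` cells only moves up, so `σ` carries at most `m(K−1)+1` terms; refinements: rank profile p444014, permutation changes
p419330 / `succ_le_card_perms_mul`).  This file proves the first CROSS-PERMUTATION constraint on such recycling.

* ONE-COLUMN EXCHANGE (`erase_sum_lt_of_dominant`, `d_lt_of_dominant_cell`): if `P` is dominant at `θ` and `Q` at `θ' > θ` and the two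
  terms use the same row at column `b₀`, then (unless they agree off `b₀`) the exponent mass OFF `b₀` is strictly larger at `Q`; and a
  shared CELL whose classes differ has strictly larger exponent at `Q`.  (The cyclewise exchange inequality of conjb-2 g4 / p437800
  `sum_d_lt_of_isDominant_invariant` for the invariant column sets `{b | b ≠ b₀}` and `{b₀}`; re-proved here by two one-class hybrids to
  keep the file import-light.)
* ROTATION LEMMA (`no_foreign_between`): if the permutation `σ` is dominant at chain positions `i < k` and its class vectors there differ
  only at column `b₀`, then NO position strictly between `i` and `k` carries a permutation `ρ ≠ σ` with `ρ b₀ = σ b₀`: between two uses of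
  `σ` separated by a single class switch of the cell `(σ b₀, b₀)` the chain can only «rotate around column `b₀`».
  Proof: the one-column exchange applied twice gives `offSlope(P_i) < offSlope(P_j) < offSlope(P_k) = offSlope(P_i)`.
* REFRESH EXCLUSIVITY (`refresh_exclusive`): call two consecutive uses `i < k` of a permutation `σ` (a STEP) TIGHT at the cell `e` if the
  two class vectors differ exactly at `e`'s column.  Two tight steps at the same cell `e` with the same new class have the same later
  endpoint (and then, by `step_fst_unique`, are the same step) — although `(m−1)!` permutations pass through `e`: «a class switch of a cell
  refreshes at most one of the permutations through it».  Proof: the rotation lemma for both permutations and cell-class monotonicity pin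
  the four positions as `i' < i < k < k'`, and then position `k` contradicts the rotation lemma of the outer step.
* Bookkeeping used by the companion file: `chain_ne` (chain terms pairwise distinct), `d_le_of_cell` / `d_lt_of_cell` (cell-class
  monotonicity along the chain), `le_fst_of_step`, `step_fst_unique`, `d_lt_of_steps_lt`.

SUCCESSOR NOTE: the rotation lemma holds verbatim for any set `C` of switched columns (intermediate terms agree with `σ`'s term on every
`σ⁻¹ρ`-invariant column set disjoint from `C`), and exclusivity generalises to «the steps whose changed cell-set is exactly `C` are totally
ordered with all new classes increasing, hence number `≤ K − 1`, for EVERY partial permutation `C`» (see the companion file's docstring for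
the counting consequence `T(m,K) = O(m!·K)`).  [this cell; the packaging is the cell's, the exchange inequality is folklore]
-/

-- `Summit.ValiantsHypothesis.ValiantsHypothesis.…` repeats a component by the D-0017 layout
-- (single-conjunct summit), which the `dupNamespace` linter flags; the name is mandated.
set_option linter.dupNamespace false
set_option autoImplicit false

namespace Summit.ValiantsHypothesis.ValiantsHypothesis.Theorems.KPlusLogSqLaw

open Summit.ValiantsHypothesis.ValiantsHypothesis.Theorems.MatrixDescartes.Negative
open Summit.ValiantsHypothesis.ValiantsHypothesis.Theorems.LacunarySymmetroidMatrixDescartes.TropicalCensus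
open Finset

namespace RefreshExclusivity

/-! ## 1. One-column surgery on a Leibniz term -/

section Terms

variable {m K : ℕ}

/-- Tropical weight after replacing the class at column `b₀` by `c` (same permutation): only the `b₀` summand moves. [folklore] -/
theorem tropWeight_update (d : Fin K → ℕ) (v : Fin m → Fin m → Fin K → ℤ) (θ : ℤ) (b₀ : Fin m) (c : Fin K)
    (p : Equiv.Perm (Fin m) × (Fin m → Fin K)) :
    tropWeight d v θ (p.1, Function.update p.2 b₀ c) =
      tropWeight d v θ p + θ * ((d c : ℤ) - d (p.2 b₀)) - (v (p.1 b₀) b₀ c - v (p.1 b₀) b₀ (p.2 b₀)) := by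
  have h1 : ∑ i, ((d (Function.update p.2 b₀ c i) : ℤ) - d (p.2 i)) = (d c : ℤ) - d (p.2 b₀) := by
    rw [Finset.sum_eq_single b₀ (fun i _ hi => by rw [Function.update_of_ne hi, sub_self])
      (fun h => absurd (mem_univ b₀) h), Function.update_self]
  have h2 : ∑ i, (v (p.1 i) i (Function.update p.2 b₀ c i) - v (p.1 i) i (p.2 i)) =
      v (p.1 b₀) b₀ c - v (p.1 b₀) b₀ (p.2 b₀) := by
    rw [Finset.sum_eq_single b₀ (fun i _ hi => by rw [Function.update_of_ne hi, sub_self])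
      (fun h => absurd (mem_univ b₀) h), Function.update_self]
  rw [Finset.sum_sub_distrib] at h1 h2
  unfold tropWeight
  dsimp only
  linear_combination θ * h1 - h2

/-- Each factor of a present term is a present incidence. [folklore] -/
theorem eps_ne_zero_of_termSign {ε : Fin m → Fin m → Fin K → ℤ} {p : Equiv.Perm (Fin m) × (Fin m → Fin K)}
    (h : termSign ε p ≠ 0) (i : Fin m) : ε (p.1 i) i (p.2 i) ≠ 0 := by
  intro hi
  apply h
  unfold termSign
  rw [Finset.prod_eq_zero (Finset.mem_univ i) hi, mul_zero]

/-- Replacing one class of a present term by a present class of the same cell keeps the term present. [folklore] -/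
theorem termSign_update_ne_zero {ε : Fin m → Fin m → Fin K → ℤ} {p : Equiv.Perm (Fin m) × (Fin m → Fin K)}
    (h : termSign ε p ≠ 0) (b₀ : Fin m) (c : Fin K) (hc : ε (p.1 b₀) b₀ c ≠ 0) :
    termSign ε (p.1, Function.update p.2 b₀ c) ≠ 0 := by
  have hall := eps_ne_zero_of_termSign h
  unfold termSign
  dsimp only
  refine mul_ne_zero (Units.ne_zero _) (Finset.prod_ne_zero_iff.mpr fun i _ => ?_)
  by_cases hi : i = b₀
  · subst hi
    rw [Function.update_self]
    exact hc
  · rw [Function.update_of_ne hi]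
    exact hall i

/-- **One-column exchange inequality (cyclewise monotonicity on `{b | b ≠ b₀}`).**  If `p` is dominant at `θ`, `q` at `θ' > θ`,
the two terms use the same row at column `b₀`, and they do not agree off `b₀`, then the exponent mass off `b₀` is strictly larger
at `q`.  Proof: `p` beats the hybrid «`q` with `p`'s class at `b₀`» at `θ`, `q` beats «`p` with `q`'s class at `b₀`» at `θ'`; add.
[folklore: convexity / exchange for parametric assignment] -/
theorem erase_sum_lt_of_dominant (d : Fin K → ℕ) (v ε : Fin m → Fin m → Fin K → ℤ) {θ θ' : ℤ}
    (hθ : θ < θ') {p q : Equiv.Perm (Fin m) × (Fin m → Fin K)} (b₀ : Fin m) (hcol : q.1 b₀ = p.1 b₀)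
    (hdiff : p.1 ≠ q.1 ∨ ∃ i, i ≠ b₀ ∧ p.2 i ≠ q.2 i)
    (hp : IsDominant d v ε θ p) (hq : IsDominant d v ε θ' q) :
    ∑ i ∈ univ.erase b₀, (d (p.2 i) : ℤ) < ∑ i ∈ univ.erase b₀, (d (q.2 i) : ℤ) := by
  have hne1 : (q.1, Function.update q.2 b₀ (p.2 b₀)) ≠ p := by
    intro h
    rcases hdiff with h' | ⟨i, hi, h'⟩
    · have h1 := congrArg Prod.fst h
      exact h' h1.symm
    · have h2 := congrFun (congrArg Prod.snd h) i
      dsimp only at h2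
      rw [Function.update_of_ne hi] at h2
      exact h' h2.symm
  have hne2 : (p.1, Function.update p.2 b₀ (q.2 b₀)) ≠ q := by
    intro h
    rcases hdiff with h' | ⟨i, hi, h'⟩
    · have h1 := congrArg Prod.fst h
      exact h' h1
    · have h2 := congrFun (congrArg Prod.snd h) i
      dsimp only at h2
      rw [Function.update_of_ne hi] at h2
      exact h' h2
  have hs1 : termSign ε (q.1, Function.update q.2 b₀ (p.2 b₀)) ≠ 0 :=
    termSign_update_ne_zero hq.1 b₀ (p.2 b₀) (by rw [hcol]; exact eps_ne_zero_of_termSign hp.1 b₀)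
  have hs2 : termSign ε (p.1, Function.update p.2 b₀ (q.2 b₀)) ≠ 0 :=
    termSign_update_ne_zero hp.1 b₀ (q.2 b₀) (by rw [← hcol]; exact eps_ne_zero_of_termSign hq.1 b₀)
  have h1 := hp.2 _ hne1 hs1
  have h2 := hq.2 _ hne2 hs2
  rw [tropWeight_update] at h1 h2
  rw [hcol] at h1
  unfold tropWeight at h1 h2
  rw [Finset.sum_erase_eq_sub (Finset.mem_univ b₀), Finset.sum_erase_eq_sub (Finset.mem_univ b₀)]
  by_contra hle
  push Not at hle
  nlinarith [mul_nonneg (sub_nonneg.mpr hθ.le) (sub_nonneg.mpr hle)]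

/-- **Cell-class monotonicity.**  If `p` is dominant at `θ`, `q` at `θ' > θ`, the two terms share the cell at column `b`
(`q.1 b = p.1 b`) and use different classes there, then the exponent of that cell's class is strictly larger at `q`.
(Equivalent to the tree's `d_lt_of_isDominant_of_sameEntry` / `d_lt_of_dominant_entry`; re-proved for self-containedness.) [folklore] -/
theorem d_lt_of_dominant_cell (d : Fin K → ℕ) (v ε : Fin m → Fin m → Fin K → ℤ) {θ θ' : ℤ} (hθ : θ < θ')
    {p q : Equiv.Perm (Fin m) × (Fin m → Fin K)} (b : Fin m) (hcol : q.1 b = p.1 b) (hcls : p.2 b ≠ q.2 b)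
    (hp : IsDominant d v ε θ p) (hq : IsDominant d v ε θ' q) : d (p.2 b) < d (q.2 b) := by
  have hne1 : (p.1, Function.update p.2 b (q.2 b)) ≠ p := by
    intro h
    have h2 := congrFun (congrArg Prod.snd h) b
    dsimp only at h2
    rw [Function.update_self] at h2
    exact hcls h2.symm
  have hne2 : (q.1, Function.update q.2 b (p.2 b)) ≠ q := by
    intro h
    have h2 := congrFun (congrArg Prod.snd h) b
    dsimp only at h2
    rw [Function.update_self] at h2
    exact hcls h2
  have hs1 : termSign ε (p.1, Function.update p.2 b (q.2 b)) ≠ 0 :=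
    termSign_update_ne_zero hp.1 b (q.2 b) (by rw [← hcol]; exact eps_ne_zero_of_termSign hq.1 b)
  have hs2 : termSign ε (q.1, Function.update q.2 b (p.2 b)) ≠ 0 :=
    termSign_update_ne_zero hq.1 b (p.2 b) (by rw [hcol]; exact eps_ne_zero_of_termSign hp.1 b)
  have h1 := hp.2 _ hne1 hs1
  have h2 := hq.2 _ hne2 hs2
  rw [tropWeight_update] at h1 h2
  rw [hcol] at h2
  have key : (d (p.2 b) : ℤ) < d (q.2 b) := by
    by_contra hle
    push Not at hle
    nlinarith [mul_nonneg (sub_nonneg.mpr hθ.le) (sub_nonneg.mpr hle)]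
  exact_mod_cast key

end Terms

/-! ## 2. Chains: cell monotonicity, distinctness, the rotation lemma, refresh exclusivity -/

section Chain

variable {m K n : ℕ} (d : Fin K → ℕ) (v ε : Fin m → Fin m → Fin K → ℤ) (θ : Fin (n + 1) → ℤ)
  (p : Fin (n + 1) → Equiv.Perm (Fin m) × (Fin m → Fin K))

/-- Along a dominant chain the class exponent of a fixed cell is non-decreasing. [folklore] -/
theorem d_le_of_cell (hθ : StrictMono θ) (hdom : ∀ k, IsDominant d v ε (θ k) (p k)) {i j : Fin (n + 1)}
    (hij : i ≤ j) (b : Fin m) (hcell : (p j).1 b = (p i).1 b) : d ((p i).2 b) ≤ d ((p j).2 b) := by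
  rcases hij.eq_or_lt with h | h
  · subst h
    exact le_rfl
  · by_cases hc : (p i).2 b = (p j).2 b
    · rw [hc]
    · exact (d_lt_of_dominant_cell d v ε (hθ h) b hcell hc (hdom i) (hdom j)).le

/-- Along a dominant chain the class exponent of a fixed cell strictly increases whenever the class changes. [folklore] -/
theorem d_lt_of_cell (hθ : StrictMono θ) (hdom : ∀ k, IsDominant d v ε (θ k) (p k)) {i j : Fin (n + 1)}
    (hij : i < j) (b : Fin m) (hcell : (p j).1 b = (p i).1 b) (hc : (p i).2 b ≠ (p j).2 b) :
    d ((p i).2 b) < d ((p j).2 b) :=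
  d_lt_of_dominant_cell d v ε (hθ hij) b hcell hc (hdom i) (hdom j)

/-- The terms of a sign-alternating dominant chain are pairwise distinct (a term dominant at `θ_i` and `θ_k` would be dominant in
between, by linearity of the weight in `θ`). [folklore] -/
theorem chain_ne (hθ : StrictMono θ) (hdom : ∀ k, IsDominant d v ε (θ k) (p k))
    (halt : ∀ k : Fin n, termSign ε (p k.castSucc) * termSign ε (p k.succ) < 0)
    {i k : Fin (n + 1)} (hik : i < k) : p i ≠ p k := by
  intro heq
  have hkn : (k : ℕ) ≤ n := Nat.lt_succ_iff.mp k.isLt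
  have hik' : (i : ℕ) < k := hik
  let j : Fin (n + 1) := ⟨(i : ℕ) + 1, by omega⟩
  have hij : i < j := by
    change (i : ℕ) < (i : ℕ) + 1
    omega
  have hjk : j ≤ k := by
    change (i : ℕ) + 1 ≤ (k : ℕ)
    omega
  -- consecutive terms differ
  have hne : p i ≠ p j := by
    intro h
    have h' := halt ⟨(i : ℕ), by omega⟩
    have e1 : (⟨(i : ℕ), by omega⟩ : Fin n).castSucc = i := Fin.ext rfl
    have e2 : (⟨(i : ℕ), by omega⟩ : Fin n).succ = j := Fin.ext rfl
    rw [e1, e2, ← h] at h'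
    exact absurd h' (not_lt.mpr (mul_self_nonneg _))
  rcases hjk.eq_or_lt with hjk' | hjk'
  · exact hne (heq.trans (by rw [hjk']))
  · have g1 := (hdom i).2 (p j) (Ne.symm hne) (hdom j).1
    have g2 := (hdom j).2 (p i) hne (hdom i).1
    have g3 := (hdom k).2 (p j) (by rw [← heq]; exact Ne.symm hne) (hdom j).1
    rw [← heq] at g3
    unfold tropWeight at g1 g2 g3
    have t1 := hθ hij
    have t2 := hθ hjk'
    have q1 : 0 < (θ j - θ i) * ((∑ x, (d ((p j).2 x) : ℤ)) - ∑ x, (d ((p i).2 x) : ℤ)) := by nlinarith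
    have q2 : (θ k - θ j) * ((∑ x, (d ((p j).2 x) : ℤ)) - ∑ x, (d ((p i).2 x) : ℤ)) < 0 := by nlinarith
    have hA : 0 < (∑ x, (d ((p j).2 x) : ℤ)) - ∑ x, (d ((p i).2 x) : ℤ) :=
      (mul_pos_iff_of_pos_left (sub_pos.mpr t1)).mp q1
    nlinarith [mul_pos (sub_pos.mpr t2) hA]

/-- **ROTATION LEMMA.**  If the permutation of the chain at positions `i < k` is the same `σ` and the two class vectors agree off the
column `b₀`, then no position strictly between `i` and `k` carries a permutation different from `σ` that uses `σ`'s row at `b₀`.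
[this cell, val-sym-trop-p4 g4] -/
theorem no_foreign_between (hθ : StrictMono θ) (hdom : ∀ k, IsDominant d v ε (θ k) (p k))
    {i j k : Fin (n + 1)} (hij : i < j) (hjk : j < k) (hik : (p i).1 = (p k).1) (b₀ : Fin m)
    (hoff : ∀ b, b ≠ b₀ → (p i).2 b = (p k).2 b) (hjb : (p j).1 b₀ = (p i).1 b₀)
    (hj : (p j).1 ≠ (p i).1) : False := by
  have h1 := erase_sum_lt_of_dominant d v ε (hθ hij) b₀ hjb (Or.inl (Ne.symm hj)) (hdom i) (hdom j)
  have h2 := erase_sum_lt_of_dominant d v ε (hθ hjk) b₀ (by rw [← hik, hjb]) (Or.inl (by rw [← hik]; exact hj))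
    (hdom j) (hdom k)
  have h3 : ∑ x ∈ univ.erase b₀, (d ((p i).2 x) : ℤ) = ∑ x ∈ univ.erase b₀, (d ((p k).2 x) : ℤ) :=
    Finset.sum_congr rfl fun x hx => by rw [hoff x (Finset.ne_of_mem_erase hx)]
  linarith

/-- Pure bookkeeping: if `(i', k')` is a step (no use of its permutation strictly inside) and `k < k'` uses the same permutation, then
`k ≤ i'`. -/
theorem le_fst_of_step {i' k' k : Fin (n + 1)} (hbtw' : ∀ j, i' < j → j < k' → (p j).1 ≠ (p k').1)
    (hperm : (p k).1 = (p k').1) (hlt : k < k') : k ≤ i' := by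
  by_contra h
  push Not at h
  exact hbtw' k h hlt hperm

/-- Pure bookkeeping: the earlier endpoint of a step is determined by the later one. -/
theorem step_fst_unique {i i' k : Fin (n + 1)} (hik : i < k) (hpi : (p i).1 = (p k).1)
    (hbtw : ∀ j, i < j → j < k → (p j).1 ≠ (p k).1) (hik' : i' < k) (hpi' : (p i').1 = (p k).1)
    (hbtw' : ∀ j, i' < j → j < k → (p j).1 ≠ (p k).1) : i = i' := by
  rcases lt_trichotomy i i' with h | h | h
  · exact (hbtw i' h hik' hpi').elim
  · exact h
  · exact (hbtw' i h hik hpi).elim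

/-- Two steps of the SAME permutation: a column changed by the later step has strictly larger exponent after the later step than
after the earlier one. [folklore] -/
theorem d_lt_of_steps_lt (hθ : StrictMono θ) (hdom : ∀ k, IsDominant d v ε (θ k) (p k)) {i' k' k : Fin (n + 1)}
    (b : Fin m) (hik' : i' < k') (hpi' : (p i').1 = (p k').1)
    (hbtw' : ∀ j, i' < j → j < k' → (p j).1 ≠ (p k').1) (hperm : (p k).1 = (p k').1) (hlt : k < k')
    (hchg' : (p i').2 b ≠ (p k').2 b) : d ((p k).2 b) < d ((p k').2 b) := by
  have hki' := le_fst_of_step p hbtw' hperm hlt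
  exact (d_le_of_cell d v ε θ p hθ hdom hki' b (by rw [hpi', hperm])).trans_lt
    (d_lt_of_cell d v ε θ p hθ hdom hik' b (by rw [hpi']) hchg')

/-- Refresh exclusivity, ordered form: two TIGHT steps `(i,k)`, `(i',k')` at the same cell (column `b`, same row) with the same new
class and `k < k'` are impossible. -/
theorem refresh_exclusive_aux (hθ : StrictMono θ) (hdom : ∀ k, IsDominant d v ε (θ k) (p k))
    {i k i' k' : Fin (n + 1)} (b : Fin m)
    (hik : i < k) (hpi : (p i).1 = (p k).1)
    (hik' : i' < k') (hpi' : (p i').1 = (p k').1) (hbtw' : ∀ j, i' < j → j < k' → (p j).1 ≠ (p k').1)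
    (hoff : ∀ b', b' ≠ b → (p i).2 b' = (p k).2 b') (hoff' : ∀ b', b' ≠ b → (p i').2 b' = (p k').2 b')
    (hchg' : (p i').2 b ≠ (p k').2 b)
    (hcell : (p k').1 b = (p k).1 b) (hcls : (p k').2 b = (p k).2 b) (hlt : k < k') : False := by
  by_cases hσ : (p k).1 = (p k').1
  · have h := d_lt_of_steps_lt d v ε θ p hθ hdom b hik' hpi' hbtw' hσ hlt hchg'
    rw [hcls] at h
    exact lt_irrefl _ h
  · -- the two permutations differ; locate `i'`
    have h1 : ¬ k < i' := by
      intro h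
      have e1 : d ((p k).2 b) ≤ d ((p i').2 b) :=
        d_le_of_cell d v ε θ p hθ hdom h.le b (by rw [hpi', hcell])
      have e2 : d ((p i').2 b) < d ((p k').2 b) :=
        d_lt_of_cell d v ε θ p hθ hdom hik' b (by rw [hpi']) hchg'
      rw [hcls] at e2
      exact lt_irrefl _ (e1.trans_lt e2)
    have h2 : i' ≠ k := by
      intro h
      apply hσ
      rw [← h]
      exact hpi'
    have h3 : ¬ (i < i' ∧ i' < k) := by
      rintro ⟨hi1, hi2⟩
      exact no_foreign_between d v ε θ p hθ hdom hi1 hi2 hpi b hoff (by rw [hpi', hcell, hpi])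
        (by rw [hpi', hpi]; exact Ne.symm hσ)
    have h4 : i' ≠ i := by
      intro h
      apply hσ
      rw [← hpi, ← h]
      exact hpi'
    have h5 : i' < i := by
      rcases lt_trichotomy i' i with h | h | h
      · exact h
      · exact absurd h h4
      · exfalso
        rcases lt_trichotomy i' k with h' | h' | h'
        · exact h3 ⟨h, h'⟩
        · exact h2 h'
        · exact h1 h'
    -- `k` lies strictly inside the step `(i', k')` of the other permutation and uses its row at `b`
    exact no_foreign_between d v ε θ p hθ hdom (h5.trans hik) hlt hpi' b hoff' (by rw [hpi', hcell])
      (by rw [hpi']; exact hσ)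

/-- **REFRESH EXCLUSIVITY.**  Two tight steps at the same cell (column `b`, same row there) with the same new class have the same later
endpoint (hence, by `step_fst_unique`, are the same step) — whatever their permutations. [this cell, val-sym-trop-p4 g4] -/
theorem refresh_exclusive (hθ : StrictMono θ) (hdom : ∀ k, IsDominant d v ε (θ k) (p k))
    {i k i' k' : Fin (n + 1)} (b : Fin m)
    (hik : i < k) (hpi : (p i).1 = (p k).1) (hbtw : ∀ j, i < j → j < k → (p j).1 ≠ (p k).1)
    (hik' : i' < k') (hpi' : (p i').1 = (p k').1) (hbtw' : ∀ j, i' < j → j < k' → (p j).1 ≠ (p k').1)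
    (hoff : ∀ b', b' ≠ b → (p i).2 b' = (p k).2 b') (hoff' : ∀ b', b' ≠ b → (p i').2 b' = (p k').2 b')
    (hchg : (p i).2 b ≠ (p k).2 b) (hchg' : (p i').2 b ≠ (p k').2 b)
    (hcell : (p k').1 b = (p k).1 b) (hcls : (p k').2 b = (p k).2 b) : k = k' := by
  by_contra hne
  rcases lt_or_gt_of_ne hne with h | h
  · exact refresh_exclusive_aux d v ε θ p hθ hdom b hik hpi hik' hpi' hbtw' hoff hoff' hchg' hcell hcls h
  · exact refresh_exclusive_aux d v ε θ p hθ hdom b hik' hpi' hik hpi hbtw hoff' hoff hchg hcell.symm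
      hcls.symm h

end Chain

end RefreshExclusivity

end Summit.ValiantsHypothesis.ValiantsHypothesis.Theorems.KPlusLogSqLaw
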